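import Mathlib
import Summits.AtomisticToContinuum.FouriersLaw.Theses.VanishingNoiseTransfer
import Summits.AtomisticToContinuum.FouriersLaw.Theorems.VanishingNoiseTransferNoisyFourierFlipCeilingBondResponse

/-!
# Sketch — crux-ideate round 2, ideator 5, crux `VanishingNoiseTransfer.VanishingNoiseBound`
(stmt-AtomisticToContinuum-11976)

Typed anchors ("First lemma") of the two round-2 idea cards:

* card `energy-dipole-leak-coercivity`:
  `integral_bondCurrent_mul_eq_liouville_pairing` (PROVED) — the overlap of any `C¹_c` observable `f` with a
  bond current `j_i` under the Gibbs density equals the pairing of its Liouvillian image `X_H f` with the left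
  block energy `E_{≤i}` (finite-`N` form of the energy-dipole identity `⟪j, f⟫ = −Σ_x x·Cov(e_x, (X_H f)_even)`);
  since `E_{≤i}` is even in every momentum, only the momentum-EVEN part of `X_H f` (the "leak") is seen.
  `OneSiteOddGap` (statement) — the frozen one-site frequency gap for functions odd in one momentum.
* card `flip-weighted-lanczos-plateau`:
  `inv_law_of_first_lanczos_zero` (PROVED, abstract) — a vanishing first Lanczos coefficient of the flip-weighted
  Liouvillian at the current (`B g = 0`) forces the `1/ε` law (Disproof §4's killing shape);
  `UniformStieltjesOfSqrtLaw` / `uniformStieltjes_of_sqrtLaw` (PROVED, abstract measure theory) — the threshold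
  `√r` law of the spectral measure gives the `ε`-uniform bound with constant `2C` (layer cake).
-/

noncomputable section

open MeasureTheory Filter Topology
open scoped ContDiff
open Literature.MathematicalPhysics.KineticTheory.HeatConduction
open Literature.MathematicalPhysics.KineticTheory.HeatConduction.HardTether (leftEnergy)
open Summit.AtomisticToContinuum.FouriersLaw.Theorems.SuperadditiveResistance.DeviceLiouville
  (liouvilleOp integral_liouvilleOp_mul)
open Summit.AtomisticToContinuum.FouriersLaw.Theorems.NoisyFourier.FlipCeiling (liouvilleOp_leftEnergy)
open Summit.AtomisticToContinuum.FouriersLaw.Theorems.VanishingNoiseBound (contDiff_leftEnergy')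

namespace Summit.AtomisticToContinuum.FouriersLaw.Cruxes.VanishingNoiseBound.Round2Ideator5

/-! ## Card `energy-dipole-leak-coercivity` -/

/-- **Current overlap = pairing of the Liouvillian image with the block energy** (finite-`N` energy-dipole
identity, per bond). For `C¹` potentials, every `C¹` compactly supported observable `f`, every length `L`,
temperature parameter `T` and bond `i`:
`∫ j_i · f · ρ_T = ∫ (X_H f) · E_{≤i} · ρ_T`.
Proof: antisymmetry of `X_H` against the Gibbs density (`integral_liouvilleOp_mul`) and the discrete continuity
equation `X_H E_{≤i} = −j_i` (`liouvilleOp_leftEnergy`). Summing over bonds: `⟨J_tot, f⟩ = ⟨X_H f, Σ_i E_{≤i}⟩`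
(`Σ_i E_{≤i}` = the tree's `leftEnergyMoment` up to the last block), and `Σ_i E_{≤i}` is even in all momenta, so
only the momentum-even component of `X_H f` (the LEAK of `f`) contributes. -/
theorem integral_bondCurrent_mul_eq_liouville_pairing (P : OscillatorChain)
    (hU : ContDiff ℝ 1 P.U) (hV : ContDiff ℝ 1 P.V) (L : ℕ) (T : ℝ) (i : Fin L)
    {f : PhaseSpace L → ℝ} (hf : ContDiff ℝ 1 f) (hfc : HasCompactSupport f) :
    ∫ x, P.bondCurrent L i x * (f x * P.gibbsDensity L T x) =
      ∫ x, liouvilleOp P L f x * (leftEnergy P L i x * P.gibbsDensity L T x) := by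
  have hE : ContDiff ℝ 1 (leftEnergy P L i) := contDiff_leftEnergy' P hU hV L i
  have h := integral_liouvilleOp_mul P hU hV L T hf hfc hE
  have hpt : ∀ x, liouvilleOp P L (leftEnergy P L i) x = -P.bondCurrent L i x := fun x =>
    liouvilleOp_leftEnergy P (hU.differentiable one_ne_zero) (hV.differentiable one_ne_zero) i x
  rw [h, ← integral_neg]
  refine integral_congr_ae (Filter.Eventually.of_forall fun x => ?_)
  simp only [hpt x]
  ring

/-- **One-site odd gap** (card `energy-dipole-leak-coercivity`, statement only). For the pinned chain
(`ω₂ > 0`, `lam, β ≥ 0`) the frozen one-site potential `q ↦ U(q) + V(a − q) + V(q − b)` is uniformly convex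
(`≥ ω₂ + 1`), so every orbit of the frozen one-site flow has frequency `≥ √(ω₂+1)` (Sturm comparison) and a
function ODD in `p_i` has zero mean on every orbit (time-reversal symmetry of the orbit); Wirtinger's inequality on
each orbit and integration over the exterior give, for every smooth compactly supported `f` with
`f ∘ flip_i = −f`:  `(ω₂ + 1) ∫ f² ρ_T ≤ ∫ (A_i f)² ρ_T`, where `A_i f = p_i ∂_{q_i} f − ∂_{q_i}H ∂_{p_i} f` is
the site-`i` summand of `X_H` (all Hermite degrees, uniform in `N`, `i`, the exterior and `T`). -/
def OneSiteOddGap : Prop :=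
  ∀ ω₂ lam β γ : ℝ, 0 < ω₂ → 0 ≤ lam → 0 ≤ β → ∀ T : ℝ, 0 < T → ∀ (L : ℕ) (i : Fin L)
    (f : PhaseSpace L → ℝ), ContDiff ℝ 1 f → HasCompactSupport f →
    (∀ x, f (momentumFlip i x) = -f x) →
      (ω₂ + 1) * ∫ x, f x ^ 2 * (pinnedChain ω₂ lam β γ).gibbsDensity L T x ≤
        ∫ x, (x.2 i * partialQ i f x -
              partialQ i ((pinnedChain ω₂ lam β γ).hamiltonian L) x * partialP i f x) ^ 2 *
            (pinnedChain ω₂ lam β γ).gibbsDensity L T x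

/-! ## Card `flip-weighted-lanczos-plateau` (abstract cores) -/

section Abstract

variable {E : Type*} [NormedAddCommGroup E] [InnerProductSpace ℝ E] [CompleteSpace E]

/-- **Vanishing first Lanczos coefficient ⇒ the `1/ε` law.** In the flip-weighted frame the noisy Green–Kubo
conductivity is `σ_ε = ε ⟪g, u_ε⟫` with `(ε² + B†B) u_ε = g`, `B` the (ε-free) flip-weighted constrained
Liouvillian and `g` the weighted current. If the Lanczos recursion terminates at step one (`B g = 0`: the current
is flip-weighted-conserved, e.g. the harmonic chain in the KLO space), then `σ_ε = ‖g‖²/ε` exactly — the killing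
shape of Disproof §4 (`cruxAt_false_of_inv_lower_bound`). Abstract Hilbert-space statement, `B†` = `adjoint`. -/
theorem inv_law_of_first_lanczos_zero (B : E →L[ℝ] E) (g u : E) {ε : ℝ} (hε : ε ≠ 0)
    (hBg : B g = 0) (hu : ε ^ 2 • u + (ContinuousLinearMap.adjoint B) (B u) = g) :
    ε * inner ℝ g u = ‖g‖ ^ 2 / ε := by
  have h1 : inner ℝ g (ε ^ 2 • u + (ContinuousLinearMap.adjoint B) (B u)) = inner ℝ g g := by rw [hu]
  rw [inner_add_right, inner_smul_right, ContinuousLinearMap.adjoint_inner_right, hBg,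
    inner_zero_left, add_zero, real_inner_self_eq_norm_sq] at h1
  have hε2 : ε ^ 2 ≠ 0 := pow_ne_zero 2 hε
  have h2 : inner ℝ g u = ‖g‖ ^ 2 / ε ^ 2 := by
    field_simp
    linarith [h1]
  rw [h2]
  field_simp

end Abstract

/-- **Threshold `√r` law ⇒ `ε`-uniform Stieltjes bound** (card `flip-weighted-lanczos-plateau`; the direction the
line USES — the converse was kernel-checked by triage r1-3, `sqrt_law_of_uniform_stieltjes_bound`). If the
spectral measure `ν` of `B†B` at the weighted current satisfies `ν(−∞, r] ≤ C √r` for all `r > 0` (bounded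
Cesàro density of the flip-weighted Liouvillian at frequency `0` — what a Lanczos PLATEAU delivers via
Dombrowski–Nevai), then `∫ ε/(ε² + |t|) dν ≤ 2C` for every `ε > 0` (layer-cake: `ν{s < ε/(ε²+|t|)} ≤ C√(ε/s)`
on `s < 1/ε`, `∫₀^{1/ε} C√(ε/s) ds = 2C`). Proved below (`uniformStieltjes_of_sqrtLaw`). -/
def UniformStieltjesOfSqrtLaw : Prop :=
  ∀ (ν : Measure ℝ) [IsFiniteMeasure ν] (C : ℝ), 0 ≤ C →
    (∀ r : ℝ, 0 < r → ν.real (Set.Iic r) ≤ C * Real.sqrt r) →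
    ∀ ε : ℝ, 0 < ε → ∫ t, ε / (ε ^ 2 + |t|) ∂ν ≤ 2 * C

end Summit.AtomisticToContinuum.FouriersLaw.Cruxes.VanishingNoiseBound.Round2Ideator5

end

/-! ## Proof of the threshold lemma (layer cake + `∫₀^{1/ε} s^{-1/2} ds = 2ε^{-1/2}`) -/

namespace Summit.AtomisticToContinuum.FouriersLaw.Cruxes.VanishingNoiseBound.Round2Ideator5

open MeasureTheory Set Real

theorem uniformStieltjes_of_sqrtLaw : UniformStieltjesOfSqrtLaw := by
  intro ν _ C hC h ε hε
  set u : ℝ → ℝ := fun t => ε / (ε ^ 2 + |t|) with hu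
  have hden : ∀ t : ℝ, 0 < ε ^ 2 + |t| := fun t => by positivity
  have hu_nn : ∀ t, 0 ≤ u t := fun t => by simp only [hu]; positivity
  have hu_le : ∀ t, u t ≤ 1 / ε := by
    intro t
    simp only [hu]
    rw [div_le_div_iff₀ (hden t) hε]
    nlinarith [abs_nonneg t, sq_nonneg ε]
  have hu_cont : Continuous u := by
    simp only [hu]
    exact continuous_const.div (continuous_const.add continuous_abs) fun t => (hden t).ne'
  have hu_int : Integrable u ν := by
    refine Integrable.mono' (integrable_const (1 / ε)) hu_cont.aestronglyMeasurable ?_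
    exact Filter.Eventually.of_forall fun t => by
      rw [Real.norm_eq_abs, abs_of_nonneg (hu_nn t)]; exact hu_le t
  -- layer cake
  rw [hu_int.integral_eq_integral_meas_lt (Filter.Eventually.of_forall hu_nn)]
  -- majorant
  set g : ℝ → ℝ := (Ioo 0 (1 / ε)).indicator fun s => C * Real.sqrt ε * s ^ (-(1 / 2 : ℝ)) with hg
  have hsub : ∀ s, 0 < s → {a : ℝ | s < u a} ⊆ Iic (ε / s) := by
    intro s hs a ha
    simp only [mem_setOf_eq, hu] at ha
    simp only [mem_Iic]
    rw [lt_div_iff₀ (hden a)] at ha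
    rw [le_div_iff₀ hs]
    nlinarith [le_abs_self a, sq_nonneg ε]
  have hempty : ∀ s, 1 / ε ≤ s → {a : ℝ | s < u a} = ∅ := by
    intro s hs
    ext a
    simp only [mem_setOf_eq, mem_empty_iff_false, iff_false, not_lt]
    exact (hu_le a).trans hs
  have hbound : ∀ s ∈ Ioi (0 : ℝ), ν.real {a : ℝ | s < u a} ≤ g s := by
    intro s hs
    simp only [mem_Ioi] at hs
    by_cases h1 : s < 1 / ε
    · have hmem : s ∈ Ioo 0 (1 / ε) := ⟨hs, h1⟩
      simp only [hg, indicator_of_mem hmem]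
      calc ν.real {a : ℝ | s < u a} ≤ ν.real (Iic (ε / s)) := measureReal_mono (hsub s hs)
        _ ≤ C * Real.sqrt (ε / s) := h _ (div_pos hε hs)
        _ = C * Real.sqrt ε * s ^ (-(1 / 2 : ℝ)) := by
          rw [Real.sqrt_div' _ hs.le, Real.sqrt_eq_rpow, Real.sqrt_eq_rpow,
            Real.rpow_neg hs.le, div_eq_mul_inv, mul_assoc]
    · push_neg at h1
      have hmem : s ∉ Ioo 0 (1 / ε) := fun hm => absurd hm.2 (not_lt.mpr h1)
      simp only [hg, indicator_of_notMem hmem, hempty s h1, measureReal_empty, le_refl]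
  -- integrability of the majorant on Ioi 0
  have hg_int : IntegrableOn g (Ioi 0) := by
    have hI : IntervalIntegrable (fun s : ℝ => s ^ (-(1 / 2 : ℝ))) volume 0 (1 / ε) :=
      intervalIntegral.intervalIntegrable_rpow' (by norm_num)
    have hI1 : IntegrableOn (fun s : ℝ => C * Real.sqrt ε * s ^ (-(1 / 2 : ℝ))) (Ioc 0 (1 / ε)) :=
      hI.1.const_mul (C * Real.sqrt ε)
    have hI' : IntegrableOn (fun s : ℝ => C * Real.sqrt ε * s ^ (-(1 / 2 : ℝ))) (Ioo 0 (1 / ε)) :=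
      hI1.mono_set Ioo_subset_Ioc_self
    have : IntegrableOn g univ := by
      rw [hg, integrableOn_univ, integrable_indicator_iff measurableSet_Ioo]
      exact hI'
    exact this.mono_set (subset_univ _)
  -- compare
  have hmono : ∫ s in Ioi 0, ν.real {a : ℝ | s < u a} ≤ ∫ s in Ioi 0, g s := by
    refine integral_mono_of_nonneg ?_ hg_int ?_
    · exact Filter.Eventually.of_forall fun s => measureReal_nonneg
    · exact ae_restrict_of_forall_mem measurableSet_Ioi fun s hs => hbound s hs
  refine hmono.trans ?_
  -- evaluate the majorant
  have hεinv : 0 ≤ 1 / ε := by positivity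
  have hval : ∫ s in Ioi 0, g s = 2 * C := by
    rw [hg, setIntegral_indicator measurableSet_Ioo,
      inter_eq_right.mpr (Ioo_subset_Ioi_self), ← integral_Ioc_eq_integral_Ioo,
      ← intervalIntegral.integral_of_le hεinv, intervalIntegral.integral_const_mul,
      integral_rpow (Or.inl (by norm_num))]
    have h12 : (-(1 / 2 : ℝ)) + 1 = 1 / 2 := by norm_num
    rw [h12, Real.zero_rpow (by norm_num), sub_zero, ← Real.sqrt_eq_rpow, Real.sqrt_div' _ hε.le,
      Real.sqrt_one]
    have hsq : Real.sqrt ε ≠ 0 := (Real.sqrt_pos.mpr hε).ne'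
    field_simp
  rw [hval]

end Summit.AtomisticToContinuum.FouriersLaw.Cruxes.VanishingNoiseBound.Round2Ideator5

/-! ## Card `energy-dipole-leak-coercivity`, cheapest falsifier (b): ring tests (non-coboundary certificates)
A translation-covariant density is a lattice coboundary only if its sum over EVERY ring vanishes identically.
The harmonic rotation-leak `Σ_x q_x (q_{x+1} − q_{x−1})` telescopes on every ring (the lattice-rotation symmetry of
the quadratic potential in the KLO sense = the `c/ε` law); the quartic one `Σ_x q_x³ (q_{x+1} − q_{x−1})` does not
(witness on `ℤ₃`), so the anharmonic leak of a lattice rotation is NOT a coboundary. -/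

namespace Summit.AtomisticToContinuum.FouriersLaw.Cruxes.VanishingNoiseBound.Round2Ideator5

/-- Harmonic rotation leak telescopes on every ring `ℤ/(n+1)`. -/
theorem harmonic_rotation_leak_ring (n : ℕ) (q : Fin (n + 1) → ℚ) :
    ∑ x, q x * (q (x + 1) - q (x - 1)) = 0 := by
  have h : ∑ x : Fin (n + 1), q x * q (x - 1) = ∑ x : Fin (n + 1), q (x + 1) * q x :=
    Fintype.sum_equiv (Equiv.subRight (1 : Fin (n + 1))) (fun x => q x * q (x - 1))
      (fun y => q (y + 1) * q y) fun x => by simp only [Equiv.subRight_apply, sub_add_cancel]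
  simp only [mul_sub, Finset.sum_sub_distrib, h]
  rw [sub_eq_zero]
  exact Finset.sum_congr rfl fun x _ => by ring

/-- Quartic rotation leak does NOT vanish on `ℤ₃`: witness `(1, 2, 0)` gives `−6`. -/
theorem quartic_rotation_leak_ring3_ne_zero :
    ∑ x : Fin 3, (![1, 2, 0] : Fin 3 → ℚ) x ^ 3 *
        ((![1, 2, 0] : Fin 3 → ℚ) (x + 1) - (![1, 2, 0] : Fin 3 → ℚ) (x - 1)) = -6 := by
  have h1 : (0 : Fin 3) + 1 = 1 := rfl
  have h2 : (1 : Fin 3) + 1 = 2 := rfl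
  have h3 : (2 : Fin 3) + 1 = 0 := rfl
  have h4 : (0 : Fin 3) - 1 = 2 := rfl
  have h5 : (1 : Fin 3) - 1 = 0 := rfl
  have h6 : (2 : Fin 3) - 1 = 1 := rfl
  simp only [Fin.sum_univ_three, h1, h2, h3, h4, h5, h6, Matrix.cons_val_zero, Matrix.cons_val_one,
    Matrix.cons_val_two, Matrix.head_cons, Matrix.tail_cons]
  norm_num

end Summit.AtomisticToContinuum.FouriersLaw.Cruxes.VanishingNoiseBound.Round2Ideator5
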